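import Summits.HodgeConjecture.HodgeConjecture.Theorems.F0P3cStCharTSStParahoricFixed     -- FILE A (this seat): `exists_torus_diag_one_one`, `cmTorusCharPair_diag_one_one`, H1, H2
import Summits.HodgeConjecture.HodgeConjecture.Theorems.F0P3cStCharTSStLevelsTransport     -- FILE C (this seat): transport of ★ BRUHAT–IWAHORI along `eA`
import Literature.NumberTheory.Automorphic.SmoothInductionDoubleCosetFixed                  -- ★ p852907 MACKEY `finrank_fixedPoints_smoothIndRep_eq_card_filter`
import HarnessLib

/-!
# F0 · P3c · line LH6 «StCharTS» — (G6)-ST FILE D: `dim i_G(χ_St(ψ₀))^{I} = 2·[ψ₀ = 1]`, `dim i_G(χ_St(ψ₀))^{K₁} = [ψ₀ = 1]` at `G_v = U(Φ₃)(L⁺_v)`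
# (RIDER 2b «EP-PAIRS», census EP-PAIRS v1 §3 (4) §5; letters of ★ (G3)-EXPLICIT)

Cell `pub/hodgecm-mathlib` (D-0151), FLOOR 0, crux item H413 = `stmt-HodgeConjecture-24833` (`--supports` lane, helper; seat F0P3a-p06 (g25)).  THEOREMS ONLY.
HONEST LABEL: count-neutral (RIDER 2b input: the principal-series side of the `I`∕`K₁` terms of `Tr St_G(ψ)(f_EP^G)`; closes no node); HC_CM is proved only modulo
the 7 printed citations (hLiu418 = stmt-HodgeConjecture-24832, h413 = stmt-HodgeConjecture-24833) until rung 0 closes.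

MATHEMATICS [Borel1976 §3–§4; Casselman1995 §3; BruhatTits1972 (4.4.4)].  By MACKEY (★ p852907) `dim (i_B χ)^K = #{{B gᵢ K} : χδ^{1/2} ≡ 1 on B ∩ gᵢKgᵢ⁻¹}` over the
decompositions `G_v = B·I ⊔ B·w̃·I` (`w̃ = eA⁻¹ w`) and `G_v = B·K₁` (FILE C).  For `χ = χ_St(ψ₀) = ((‖·‖^{1/2}‖·‖^{1/2})⁻¹, ψ₀)`: if `ψ₀ = 1` the inducing line is trivial on
`B ∩ K_v` (unit diagonal, `δ = 1` on compacts; §1) and on `B ∩ K₁` (integral diagonal of an upper-triangular unitary ⇒ units, FILE C; §1), and `B ∩ w̃Iw̃⁻¹ ≤ B ∩ K_v`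
(`w̃ ∈ K₀ = K_v`), so every cell counts: `2` resp. `1`; if `ψ₀ ≠ 1` the element `t = d(1,b,1)` with `ψ₀ b ≠ 1` lies in `B ∩ I ∩ w̃Iw̃⁻¹ ∩ K₁` (`w̃⁻¹ t w̃ = t`) and acts by
`ψ₀(b)` on the line, so no cell counts: `0`.
* §1 `inducingLine_eq_one_of_valued_eq_one`, `inducingLine_eq_one_of_mem_integralLevel`, `valued_diag_le_one_of_mem_K1`, `inducingLine_eq_one_of_mem_K1`,
  `weylLongU_mul_mul_weylLongU_eq_of_diag` · §2 `exists_witness` · §3 **`finrank_fixedPoints_cmPrincipalSeries_stChar_I`**, **`finrank_fixedPoints_cmPrincipalSeries_stChar_K1`**.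

## References
* [Borel1976] A. Borel, *Admissible representations of a semi-simple group over a local field with vectors fixed under an Iwahori subgroup*, Invent. Math. 35 (1976), §3–§4.
* [Casselman1995] W. Casselman, *Introduction to the theory of admissible representations of 𝔭-adic reductive groups* (1995), Prop. 1.3.1, §3.
* [BruhatTits1972] F. Bruhat, J. Tits, *Groupes réductifs sur un corps local I*, Publ. Math. IHÉS 41 (1972), (4.4.4).
* [Rogawski1990] J. D. Rogawski, *Automorphic Representations of Unitary Groups in Three Variables*, Ann. of Math. Stud. 123 (1990), §12.2 (1) p. 173, §4.5 p. 45.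
-/

set_option autoImplicit false
-- the mandated namespace has the single-problem summit's repeated segment (`HodgeConjecture.HodgeConjecture`)
set_option linter.dupNamespace false

noncomputable section

open NumberField IsDedekindDomain MeasureTheory
open scoped Matrix MatrixGroups NNReal WithZero
open Literature.NumberTheory.Automorphic Literature.NumberTheory.Automorphic.UnitaryGroup
open Literature.NumberTheory.Rogawski1990 Literature.NumberTheory.GaloisRepresentations

namespace Summit.HodgeConjecture.HodgeConjecture.Cruxes.H413.F0P3cStCharTSStIwahoriFixed

open Summit.HodgeConjecture.HodgeConjecture.Cruxes.H413
open Summit.HodgeConjecture.HodgeConjecture.Cruxes.H413.F0P3cStCharTSStParahoricFixed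
open Summit.HodgeConjecture.HodgeConjecture.Cruxes.H413.F0P3cStCharTSStLevelsTransport

variable (L : Type) [Field L] [NumberField L] [IsCMField L] (v : HeightOneSpectrum (𝓞 ↥(maximalRealSubfield L)))
  (w : PlacesOver L v) (hw : IsCMField.complexConj L • w.1 = w.1)
  (eA : Gqs L v ≃ₜ* ↥(unitaryGroupOfForm (galAdicCompletionMap (L := L) (IsCMField.complexConj L) hw) ((StdForm.antidiagonal 3).over (w.1.adicCompletion L))))
  (heA : ∀ g : Gqs L v,
    ((eA g : ↥(unitaryGroupOfForm (galAdicCompletionMap (L := L) (IsCMField.complexConj L) hw) ((StdForm.antidiagonal 3).over (w.1.adicCompletion L)))) :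
        GL (Fin 3) (w.1.adicCompletion L)) =
      ((localNonsplitEquiv (IsCMField.complexConj L) (qsForm L) (IsCMField.complexConj_ne_one L) w hw g :
        ↥(unitaryGroupOfForm (galAdicCompletionMap (L := L) (IsCMField.complexConj L) hw) (placeForm (qsForm L) w.1))) : GL (Fin 3) (w.1.adicCompletion L)))

/-! ## §1 The inducing line of `χ_St(1)` is trivial on `B ∩ K_v` and on `B ∩ K₁`; `w̃⁻¹ d(1,b,1) w̃ = d(1,b,1)` -/

set_option maxHeartbeats 1600000 in
-- instance-path unification between `Gqs L v` and the literal carrier of ★ `cmPrincipalSeries`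
/-- **The inducing line of `χ_St(1)` is trivial on `B ∩ K`** for any compact `K` and `h ∈ B ∩ K` with `|h₀₀|_w = 1`: `δ_B^{1/2}(h) = 1` (★ `rootDeltaChar_borel_eq_one_of_mem_isCompact`)
and `χ_St(1)(proj h) = (‖h₀₀‖^{1/2}‖h₀₀‖^{1/2})⁻¹ = 1` (★ `halfModulusChar_eq_one_of_forall_v_eq_one`, `(proj h)₀₀ = h₀₀` ★ `coe_torusEntry_proj_borelTriple`).
[cite: Rogawski1990, §4.5 p. 45; §12.2 (1) p. 173] [cite: CartierCorvallis1979, §IV.1] -/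
theorem inducingLine_eq_one_of_valued_eq_one {K : Subgroup ↥(unitaryGroupOfForm (conjLocal L (IsCMField.complexConj L) v) (cmLocalForm L 3 v))}
    (hKc : IsCompact (K : Set ↥(unitaryGroupOfForm (conjLocal L (IsCMField.complexConj L) v) (cmLocalForm L 3 v))))
    (h : ↥(cmBorelTriple L 3 v).P) (hh : (h : ↥(unitaryGroupOfForm (conjLocal L (IsCMField.complexConj L) v) (cmLocalForm L 3 v))) ∈ K)
    (h00 : ∀ w' : PlacesOver L v, Valued.v ((((h : ↥(unitaryGroupOfForm (conjLocal L (IsCMField.complexConj L) v) (cmLocalForm L 3 v))) :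
      GL (Fin 3) (LocalRing L v)).val 0 0) w') = 1) :
    haveI := locallyCompactSpace_cmBorelU L 3 v
    (Representation.twist
      (((Representation.trivial ℂ ↥(torusU (conjLocal L (IsCMField.complexConj L) v) (cmLocalForm L 3 v)) ℂ).twist
        (cmTorusCharPair L v (halfModulusChar (LocalRing L v) * halfModulusChar (LocalRing L v))⁻¹ 1)).comp (cmBorelTriple L 3 v).proj)
      (rootDeltaChar (cmBorelTriple L 3 v).P)) h = 1 := by
  haveI := locallyCompactSpace_cmBorelU L 3 v
  have hδ : rootDeltaChar (cmBorelTriple L 3 v).P h = 1 := rootDeltaChar_borel_eq_one_of_mem_isCompact _ _ (cmLocalForm_eq_over L 3 v) hKc h hh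
  have hu : halfModulusChar (LocalRing L v) (torusEntry (conjLocal L (IsCMField.complexConj L) v) (cmLocalForm L 3 v) 0 ((cmBorelTriple L 3 v).proj h)) = 1 := by
    refine halfModulusChar_eq_one_of_forall_v_eq_one L v _ fun w' => ?_
    rw [coe_torusEntry_proj_borelTriple]
    exact h00 w'
  apply LinearMap.ext
  intro z
  rw [Representation.twist_apply, hδ, Units.val_one, one_smul, MonoidHom.comp_apply, Representation.twist_apply, Representation.trivial_apply,
    cmTorusCharPair, torusCharPair_apply, MonoidHom.one_apply, mul_one, MonoidHom.inv_apply, MonoidHom.mul_apply, hu, mul_one, inv_one, Units.val_one, one_smul,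
    Module.End.one_apply]

/-- On `B ∩ K_v` the inducing line of `χ_St(1)` is trivial (`K_v` compact ★, diagonal of valuation one ★ `v_torusEntry_eq_one_of_mem_cmLocalIntegralLevel`).
[cite: Rogawski1990, §4.5 p. 45] [cite: CartierCorvallis1979, §IV.1] -/
theorem inducingLine_eq_one_of_mem_integralLevel (h : ↥(cmBorelTriple L 3 v).P)
    (hh : (h : ↥(unitaryGroupOfForm (conjLocal L (IsCMField.complexConj L) v) (cmLocalForm L 3 v))) ∈ cmLocalIntegralLevel L 3 (qsForm L) v) :
    haveI := locallyCompactSpace_cmBorelU L 3 v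
    (Representation.twist
      (((Representation.trivial ℂ ↥(torusU (conjLocal L (IsCMField.complexConj L) v) (cmLocalForm L 3 v)) ℂ).twist
        (cmTorusCharPair L v (halfModulusChar (LocalRing L v) * halfModulusChar (LocalRing L v))⁻¹ 1)).comp (cmBorelTriple L 3 v).proj)
      (rootDeltaChar (cmBorelTriple L 3 v).P)) h = 1 := by
  refine inducingLine_eq_one_of_valued_eq_one L v (isCompact_isOpen_cmLocalIntegralLevel L 3 (qsForm L) v).1 h hh fun w' => ?_
  rw [← coe_torusEntry_proj_borelTriple]
  exact v_torusEntry_eq_one_of_mem_cmLocalIntegralLevel L 3 v _ (proj_mem_cmLocalIntegralLevel L 3 v h hh) 0 w'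

include heA in
/-- **On `B ∩ K₁` the diagonal is integral**: `g₁⁻¹ (eA h) g₁ ∈ GL₃(𝒪_w)` (★ `mem_conj_glInt_subgroupOf_iff`) has the same diagonal as `eA h` (★ `coe_conj_apply_of_eq`), whose
entries are the `hᵢᵢ(w)` (FILE C `coe_eA_apply`). [cite: Tits1979, §3.3.2] [cite: Kottwitz1988, §2] -/
theorem valued_diag_le_one_of_mem_K1 {ϖ : w.1.adicCompletion L}
    (hd : HermitianLattice.UnramifiedLocalConjDatum (galAdicCompletionMap (L := L) (IsCMField.complexConj L) hw) ϖ)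
    (g₁ : GL (Fin 3) (w.1.adicCompletion L)) (hg₁ : (g₁ : Matrix (Fin 3) (Fin 3) (w.1.adicCompletion L)) = Matrix.diagonal ![(1 : w.1.adicCompletion L), 1, ϖ])
    (K1 : Subgroup (Gqs L v))
    (hK1 : K1 = (((glInt 3 (w.1.adicCompletion L)).map (MulAut.conj g₁).toMonoidHom).subgroupOf
      (unitaryGroupOfForm (galAdicCompletionMap (L := L) (IsCMField.complexConj L) hw) ((StdForm.antidiagonal 3).over (w.1.adicCompletion L)))).comap
        eA.toMulEquiv.toMonoidHom)
    (g : Gqs L v) (hg : g ∈ K1) (i : Fin 3) :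
    Valued.v ((g.val.val : Matrix (Fin 3) (Fin 3) (LocalRing L v)) i i w) ≤ 1 := by
  subst hK1
  have hϖ0 : ϖ ≠ 0 := CartanUnique.uniformizer_ne_zero hd.vϖ
  have hmem := (mem_conj_glInt_subgroupOf_iff (galAdicCompletionMap (L := L) (IsCMField.complexConj L) hw) g₁ (eA g)).1
    ((mem_comap_iff L v w hw eA _ g).1 hg)
  have hint := ((_root_.Literature.NumberTheory.Automorphic.mem_glInt_iff_forall_v_le_one _).1 hmem).1 i i
  rw [coe_conj_apply_of_eq g₁ hg₁ hϖ0, coe_eA_apply L v w hw eA heA g i i] at hint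
  have hdi : (![(1 : w.1.adicCompletion L), 1, ϖ] i) ≠ 0 := by fin_cases i <;> simp [hϖ0]
  rwa [mul_assoc, mul_comm ((g.val.val : Matrix (Fin 3) (Fin 3) (LocalRing L v)) i i w), ← mul_assoc, inv_mul_cancel₀ hdi, one_mul] at hint

include heA in
/-- **On `B ∩ K₁` the inducing line of `χ_St(1)` is trivial**: integral diagonal (§1) of an upper-triangular unitary ⇒ unit diagonal (FILE C
`valued_diag_eq_one_of_mem_borel_of_forall_le`), and `K₁` is compact (FILE C). [cite: Tits1979, §3.3.2] [cite: Rogawski1990, §4.5 p. 45] -/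
theorem inducingLine_eq_one_of_mem_K1 {ϖ : w.1.adicCompletion L}
    (hd : HermitianLattice.UnramifiedLocalConjDatum (galAdicCompletionMap (L := L) (IsCMField.complexConj L) hw) ϖ)
    (g₁ : GL (Fin 3) (w.1.adicCompletion L)) (hg₁ : (g₁ : Matrix (Fin 3) (Fin 3) (w.1.adicCompletion L)) = Matrix.diagonal ![(1 : w.1.adicCompletion L), 1, ϖ])
    (K0 K1 I : Subgroup (Gqs L v))
    (hK0 : K0 = ((glInt 3 (w.1.adicCompletion L)).subgroupOf
      (unitaryGroupOfForm (galAdicCompletionMap (L := L) (IsCMField.complexConj L) hw) ((StdForm.antidiagonal 3).over (w.1.adicCompletion L)))).comap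
        eA.toMulEquiv.toMonoidHom)
    (hK1 : K1 = (((glInt 3 (w.1.adicCompletion L)).map (MulAut.conj g₁).toMonoidHom).subgroupOf
      (unitaryGroupOfForm (galAdicCompletionMap (L := L) (IsCMField.complexConj L) hw) ((StdForm.antidiagonal 3).over (w.1.adicCompletion L)))).comap
        eA.toMulEquiv.toMonoidHom)
    (hI : I = K0 ⊓ K1)
    (h : ↥(cmBorelTriple L 3 v).P) (hh : (h : ↥(unitaryGroupOfForm (conjLocal L (IsCMField.complexConj L) v) (cmLocalForm L 3 v))) ∈ K1) :
    haveI := locallyCompactSpace_cmBorelU L 3 v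
    (Representation.twist
      (((Representation.trivial ℂ ↥(torusU (conjLocal L (IsCMField.complexConj L) v) (cmLocalForm L 3 v)) ℂ).twist
        (cmTorusCharPair L v (halfModulusChar (LocalRing L v) * halfModulusChar (LocalRing L v))⁻¹ 1)).comp (cmBorelTriple L 3 v).proj)
      (rootDeltaChar (cmBorelTriple L 3 v).P)) h = 1 := by
  haveI : Subsingleton (PlacesOver L v) := PlacesOver.subsingleton_of_smul_eq (IsCMField.complexConj L) (IsCMField.complexConj_ne_one L) w hw
  have hK1c := (isOpen_isCompact_levels L v w hw eA g₁ K0 K1 I hK0 hK1 hI).2.1.2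
  refine inducingLine_eq_one_of_valued_eq_one L v (K := K1) hK1c h hh fun w' => ?_
  obtain rfl : w' = w := Subsingleton.elim _ _
  exact valued_diag_eq_one_of_mem_borel_of_forall_le L v w' hw eA heA hd.vσ _ h.2
    (fun i => valued_diag_le_one_of_mem_K1 L v w' hw eA heA hd g₁ hg₁ K1 hK1 _ hh i) 0

/-- **`w · d · w = d` in the model for `d = eA t` with matrix `diag(1, β, 1)`** (`(w g w)ᵢⱼ = g_{rev i, rev j}` ★ `coe_weylLongU_mul_mul_weylLongU_apply'`).
[cite: Rogawski1990, §1.10 p. 9] -/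
theorem weylLongU_mul_mul_weylLongU_eq_of_diag {K : Type*} [Field K] [Valued K ℤᵐ⁰] [ValuativeRel K] [(Valued.v : Valuation K ℤᵐ⁰).Compatible]
    (σ : K →+* K) {J : Matrix (Fin 3) (Fin 3) K} (hJ : J = (StdForm.antidiagonal 3).over K) (x : ↥(unitaryGroupOfForm σ J)) (β : K)
    (hx : ((x : GL (Fin 3) K) : Matrix (Fin 3) (Fin 3) K) = Matrix.diagonal ![(1 : K), β, 1]) :
    weylLongU σ hJ * x * weylLongU σ hJ = x := by
  apply Subtype.ext; apply Units.ext
  ext i j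
  rw [coe_weylLongU_mul_mul_weylLongU_apply', hx, Matrix.diagonal_apply, Matrix.diagonal_apply]
  fin_cases i <;> fin_cases j <;> rfl


/-! ## §2 The witness `t = d(1,b,1)` for `ψ₀ b ≠ 1`: in `B ∩ I`, fixed by `w̃`-conjugation, acting by `ψ₀(b) ≠ 1` on the inducing line -/

include heA in
set_option maxHeartbeats 1600000 in
-- instance-path unification between `Gqs L v` and the literal carrier of ★ `cmPrincipalSeries`
/-- **The witness**: for `b ∈ E¹_v` there is `t ∈ B_v` (a torus element with matrix `diag(1,b,1)`, FILE A) lying in every cell's conjugate of `I`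
(`t ∈ I` by FILE C, and `w̃⁻¹ t w̃ = t`: `w (eA t) w = eA t`, `w² = 1`), on which the inducing line of `χ_St(ψ₀)` acts by the scalar `ψ₀(b)` (FILE A `cmTorusCharPair_diag_one_one`,
`δ = 1` on `K_v`). [cite: Rogawski1990, §1.10 p. 9; §12.1 p. 171] [cite: BruhatTits1972, (4.4.4)] -/
theorem exists_witness (hns : ∀ w' : PlacesOver L v, IsCMField.complexConj L • w'.1 = w'.1) {ϖ : w.1.adicCompletion L} (hd : HermitianLattice.UnramifiedLocalConjDatum (galAdicCompletionMap (L := L) (IsCMField.complexConj L) hw) ϖ)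
    (g₁ : GL (Fin 3) (w.1.adicCompletion L)) (hg₁ : (g₁ : Matrix (Fin 3) (Fin 3) (w.1.adicCompletion L)) = Matrix.diagonal ![(1 : w.1.adicCompletion L), 1, ϖ])
    (K0 K1 I : Subgroup (Gqs L v))
    (hK0 : K0 = ((glInt 3 (w.1.adicCompletion L)).subgroupOf
      (unitaryGroupOfForm (galAdicCompletionMap (L := L) (IsCMField.complexConj L) hw) ((StdForm.antidiagonal 3).over (w.1.adicCompletion L)))).comap
        eA.toMulEquiv.toMonoidHom)
    (hK1 : K1 = (((glInt 3 (w.1.adicCompletion L)).map (MulAut.conj g₁).toMonoidHom).subgroupOf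
      (unitaryGroupOfForm (galAdicCompletionMap (L := L) (IsCMField.complexConj L) hw) ((StdForm.antidiagonal 3).over (w.1.adicCompletion L)))).comap
        eA.toMulEquiv.toMonoidHom)
    (hI : I = K0 ⊓ K1)
    (ψ₀ : ↥(normOneUnits (conjLocal L (IsCMField.complexConj L) v)) →* ℂˣ) (b : ↥(normOneUnits (conjLocal L (IsCMField.complexConj L) v))) :
    haveI := locallyCompactSpace_cmBorelU L 3 v
    ∃ p : ↥(cmBorelTriple L 3 v).P,
      (∀ i : Fin 2, (![(1 : ↥(unitaryGroupOfForm (conjLocal L (IsCMField.complexConj L) v) (cmLocalForm L 3 v))), eA.symm (weylLongU (galAdicCompletionMap (L := L) (IsCMField.complexConj L) hw) (rfl : (StdForm.antidiagonal 3).over (w.1.adicCompletion L) = _))] i)⁻¹ * (p : ↥(unitaryGroupOfForm (conjLocal L (IsCMField.complexConj L) v) (cmLocalForm L 3 v))) * (![(1 : ↥(unitaryGroupOfForm (conjLocal L (IsCMField.complexConj L) v) (cmLocalForm L 3 v))), eA.symm (weylLongU (galAdicCompletionMap (L := L) (IsCMField.complexConj L) hw) (rfl : (StdForm.antidiagonal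 3).over (w.1.adicCompletion L) = _))] i) ∈ I) ∧
      (Representation.twist
      (((Representation.trivial ℂ ↥(torusU (conjLocal L (IsCMField.complexConj L) v) (cmLocalForm L 3 v)) ℂ).twist
        (cmTorusCharPair L v (halfModulusChar (LocalRing L v) * halfModulusChar (LocalRing L v))⁻¹ ψ₀)).comp (cmBorelTriple L 3 v).proj)
      (rootDeltaChar (cmBorelTriple L 3 v).P)) p = ((ψ₀ b : ℂˣ) : ℂ) • (1 : ℂ →ₗ[ℂ] ℂ) := by
  haveI := locallyCompactSpace_cmBorelU L 3 v
  obtain ⟨t, ht, htK⟩ := exists_torus_diag_one_one L v hns b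
  have htB : ((t : ↥(unitaryGroupOfForm (conjLocal L (IsCMField.complexConj L) v) (cmLocalForm L 3 v))) ∈ (cmBorelTriple L 3 v).P) := torusU_le_borelU _ _ t.2
  have htmat : ((t : ↥(unitaryGroupOfForm (conjLocal L (IsCMField.complexConj L) v) (cmLocalForm L 3 v))).val.val : Matrix (Fin 3) (Fin 3) (LocalRing L v)) = Matrix.diagonal ![(1 : LocalRing L v), ((b : (LocalRing L v)ˣ) : LocalRing L v), 1] := by
    have htval : (t : ↥(unitaryGroupOfForm (conjLocal L (IsCMField.complexConj L) v) (cmLocalForm L 3 v))).val = glDiagonal 3 (LocalRing L v) ![(1 : (LocalRing L v)ˣ), (b : (LocalRing L v)ˣ), 1] := ht.symm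
    rw [htval, coe_glDiagonal]
    congr 1
    funext k
    fin_cases k <;> rfl
  have htI : (t : ↥(unitaryGroupOfForm (conjLocal L (IsCMField.complexConj L) v) (cmLocalForm L 3 v))) ∈ I := mem_I_of_coe_eq_diagonal L v w hw eA heA hns hd g₁ hg₁ K0 K1 I hK0 hK1 hI b _ htmat
  -- `w̃⁻¹ t w̃ = t`, pushed through the one-place model
  let eU : ↥(unitaryGroupOfForm (conjLocal L (IsCMField.complexConj L) v) (cmLocalForm L 3 v)) ≃ₜ* ↥(unitaryGroupOfForm (galAdicCompletionMap (L := L) (IsCMField.complexConj L) hw) ((StdForm.antidiagonal 3).over (w.1.adicCompletion L))) := eA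
  have hte : (((eU (t : ↥(unitaryGroupOfForm (conjLocal L (IsCMField.complexConj L) v) (cmLocalForm L 3 v))) : ↥(unitaryGroupOfForm (galAdicCompletionMap (L := L) (IsCMField.complexConj L) hw) ((StdForm.antidiagonal 3).over (w.1.adicCompletion L)))) : GL (Fin 3) (w.1.adicCompletion L)) : Matrix (Fin 3) (Fin 3) (w.1.adicCompletion L)) =
      Matrix.diagonal ![(1 : w.1.adicCompletion L), ((b : (LocalRing L v)ˣ) : LocalRing L v) w, 1] := by
    refine Matrix.ext fun i j => ?_
    refine (coe_eA_apply L v w hw eA heA _ i j).trans ?_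
    rw [htmat, Matrix.diagonal_apply, Matrix.diagonal_apply]
    split_ifs with hij
    · subst hij; fin_cases i <;> rfl
    · rfl
  have hww : (weylLongU (galAdicCompletionMap (L := L) (IsCMField.complexConj L) hw) (rfl : (StdForm.antidiagonal 3).over (w.1.adicCompletion L) = _)) * (weylLongU (galAdicCompletionMap (L := L) (IsCMField.complexConj L) hw) (rfl : (StdForm.antidiagonal 3).over (w.1.adicCompletion L) = _)) = 1 := by
    apply Subtype.ext; rw [Subgroup.coe_mul, coe_weylLongU, Subgroup.coe_one]; exact weylLong_mul_self 3 _
  have hwinv : (weylLongU (galAdicCompletionMap (L := L) (IsCMField.complexConj L) hw) (rfl : (StdForm.antidiagonal 3).over (w.1.adicCompletion L) = _))⁻¹ = (weylLongU (galAdicCompletionMap (L := L) (IsCMField.complexConj L) hw) (rfl : (StdForm.antidiagonal 3).over (w.1.adicCompletion L) = _)) := inv_eq_of_mul_eq_one_right hww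
  have hfix : (![(1 : ↥(unitaryGroupOfForm (conjLocal L (IsCMField.complexConj L) v) (cmLocalForm L 3 v))), eA.symm (weylLongU (galAdicCompletionMap (L := L) (IsCMField.complexConj L) hw) (rfl : (StdForm.antidiagonal 3).over (w.1.adicCompletion L) = _))] 1)⁻¹ * (t : ↥(unitaryGroupOfForm (conjLocal L (IsCMField.complexConj L) v) (cmLocalForm L 3 v))) * (![(1 : ↥(unitaryGroupOfForm (conjLocal L (IsCMField.complexConj L) v) (cmLocalForm L 3 v))), eA.symm (weylLongU (galAdicCompletionMap (L := L) (IsCMField.complexConj L) hw) (rfl : (StdForm.antidiagonal 3).over (w.1.adicCompletion L) = _))] 1) = t := by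
    apply eU.injective
    rw [map_mul, map_mul, map_inv, eA_vec L v w hw eA 1]
    simp only [Matrix.cons_val_one, Matrix.cons_val_fin_one]
    rw [hwinv]
    exact weylLongU_mul_mul_weylLongU_eq_of_diag _ rfl _ _ hte
  refine ⟨⟨_, htB⟩, fun i => ?_, ?_⟩
  · fin_cases i
    · simpa using htI
    · convert htI using 2
      exact hfix
  · -- the value on the line
    have hproj : (cmBorelTriple L 3 v).proj ⟨_, htB⟩ = t := by
      apply Subtype.ext
      exact (cmBorelTriple L 3 v).proj_apply_of_mem_M ⟨_, htB⟩ t.2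
    have hδ : rootDeltaChar (cmBorelTriple L 3 v).P ⟨_, htB⟩ = 1 :=
      rootDeltaChar_borel_eq_one_of_mem_isCompact _ _ (cmLocalForm_eq_over L 3 v) (isCompact_isOpen_cmLocalIntegralLevel L 3 (qsForm L) v).1 ⟨_, htB⟩ htK
    have hχ : cmTorusCharPair L v (halfModulusChar (LocalRing L v) * halfModulusChar (LocalRing L v))⁻¹ ψ₀ t = ψ₀ b :=
      cmTorusCharPair_diag_one_one L v _ ψ₀ b t ht
    apply LinearMap.ext
    intro z
    rw [Representation.twist_apply, hδ, Units.val_one, one_smul, MonoidHom.comp_apply, hproj, Representation.twist_apply, Representation.trivial_apply,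
      hχ, LinearMap.smul_apply, Module.End.one_apply]

/-! ## §3 The counts `dim i_G(χ_St(ψ₀))^{I} = 2·[ψ₀ = 1]` and `dim i_G(χ_St(ψ₀))^{K₁} = [ψ₀ = 1]` -/

include heA in
open Classical in
set_option maxHeartbeats 1600000 in
set_option synthInstance.maxHeartbeats 400000 in
-- instance-path unification between `Gqs L v` and the literal carrier of ★ `cmPrincipalSeries`
/-- **`dim i_G(χ_St(ψ₀))^{I} = 2` if `ψ₀ = 1`, `= 0` otherwise** (MACKEY ★ `finrank_fixedPoints_smoothIndRep_eq_card_filter` over `G_v = B·I ⊔ B·w̃·I`, FILE C; §1, §2).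
[cite: Borel1976, §3–§4] [cite: Casselman1995, Prop. 1.3.1, §3] [cite: BruhatTits1972, (4.4.4)] -/
theorem finrank_fixedPoints_cmPrincipalSeries_stChar_I (hns : ∀ w' : PlacesOver L v, IsCMField.complexConj L • w'.1 = w'.1) {ϖ : w.1.adicCompletion L} (hd : HermitianLattice.UnramifiedLocalConjDatum (galAdicCompletionMap (L := L) (IsCMField.complexConj L) hw) ϖ)
    (g₁ : GL (Fin 3) (w.1.adicCompletion L)) (hg₁ : (g₁ : Matrix (Fin 3) (Fin 3) (w.1.adicCompletion L)) = Matrix.diagonal ![(1 : w.1.adicCompletion L), 1, ϖ])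
    (K0 K1 I : Subgroup (Gqs L v))
    (hK0 : K0 = ((glInt 3 (w.1.adicCompletion L)).subgroupOf
      (unitaryGroupOfForm (galAdicCompletionMap (L := L) (IsCMField.complexConj L) hw) ((StdForm.antidiagonal 3).over (w.1.adicCompletion L)))).comap
        eA.toMulEquiv.toMonoidHom)
    (hK1 : K1 = (((glInt 3 (w.1.adicCompletion L)).map (MulAut.conj g₁).toMonoidHom).subgroupOf
      (unitaryGroupOfForm (galAdicCompletionMap (L := L) (IsCMField.complexConj L) hw) ((StdForm.antidiagonal 3).over (w.1.adicCompletion L)))).comap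
        eA.toMulEquiv.toMonoidHom)
    (hI : I = K0 ⊓ K1)
    (ψ₀ : ↥(normOneUnits (conjLocal L (IsCMField.complexConj L) v)) →* ℂˣ) :
    Module.finrank ℂ ((cmPrincipalSeries L 3 v (cmTorusCharPair L v (halfModulusChar (LocalRing L v) * halfModulusChar (LocalRing L v))⁻¹ ψ₀)).fixedPoints I) = if ψ₀ = 1 then 2 else 0 := by
  haveI := locallyCompactSpace_cmBorelU L 3 v
  have hIo' := (isOpen_isCompact_levels L v w hw eA g₁ K0 K1 I hK0 hK1 hI).2.2.1
  have hIo : @IsOpen ↥(unitaryGroupOfForm (conjLocal L (IsCMField.complexConj L) v) (cmLocalForm L 3 v)) inferInstance (I : Set (Gqs L v)) := hIo'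
  have hM := Representation.finrank_fixedPoints_smoothIndRep_eq_card_filter (Representation.twist
      (((Representation.trivial ℂ ↥(torusU (conjLocal L (IsCMField.complexConj L) v) (cmLocalForm L 3 v)) ℂ).twist
        (cmTorusCharPair L v (halfModulusChar (LocalRing L v) * halfModulusChar (LocalRing L v))⁻¹ ψ₀)).comp (cmBorelTriple L 3 v).proj)
      (rootDeltaChar (cmBorelTriple L 3 v).P)) hIo
    (cover_borel_I L v w hw eA heA hd g₁ hg₁ K0 K1 I hK0 hK1 hI) (disj_borel_I L v w hw eA heA hd g₁ hg₁ K0 K1 I hK0 hK1 hI) (Module.finrank_self ℂ)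
  refine hM.trans ?_
  -- membership bookkeeping in `K0`, typed on the carrier of the principal series
  have mulK0 : ∀ x y : ↥(unitaryGroupOfForm (conjLocal L (IsCMField.complexConj L) v) (cmLocalForm L 3 v)), x ∈ K0 → y ∈ K0 → x * y ∈ K0 := fun x y hx hy => K0.mul_mem hx hy
  have invK0 : ∀ x : ↥(unitaryGroupOfForm (conjLocal L (IsCMField.complexConj L) v) (cmLocalForm L 3 v)), x ∈ K0 → x⁻¹ ∈ K0 := fun x hx => K0.inv_mem hx
  have hw0 : (![(1 : ↥(unitaryGroupOfForm (conjLocal L (IsCMField.complexConj L) v) (cmLocalForm L 3 v))), eA.symm (weylLongU (galAdicCompletionMap (L := L) (IsCMField.complexConj L) hw) (rfl : (StdForm.antidiagonal 3).over (w.1.adicCompletion L) = _))] 1) ∈ K0 := eA_symm_weylLongU_mem_K0 L v w hw eA K0 hK0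
  have hIK0 : ∀ x : ↥(unitaryGroupOfForm (conjLocal L (IsCMField.complexConj L) v) (cmLocalForm L 3 v)), x ∈ I → x ∈ K0 := fun x hx => I_le_K0 L v K0 K1 I hI hx
  by_cases h1 : ψ₀ = 1
  · subst h1
    rw [if_pos rfl, Finset.filter_true_of_mem, Finset.card_univ, Fintype.card_fin]
    intro i _ h hmem
    have hmem' : (![(1 : ↥(unitaryGroupOfForm (conjLocal L (IsCMField.complexConj L) v) (cmLocalForm L 3 v))), eA.symm (weylLongU (galAdicCompletionMap (L := L) (IsCMField.complexConj L) hw) (rfl : (StdForm.antidiagonal 3).over (w.1.adicCompletion L) = _))] i)⁻¹ * (h : ↥(unitaryGroupOfForm (conjLocal L (IsCMField.complexConj L) v) (cmLocalForm L 3 v))) * (![(1 : ↥(unitaryGroupOfForm (conjLocal L (IsCMField.complexConj L) v) (cmLocalForm L 3 v))), eA.symm (weylLongU (galAdicCompletionMap (L := L) (IsCMField.complexConj L) hw) (rfl : (StdForm.antidiagonal 3).over (w.1.adicCompletion L) = _))] i) ∈ I := hmem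
    have hhK0 : (h : ↥(unitaryGroupOfForm (conjLocal L (IsCMField.complexConj L) v) (cmLocalForm L 3 v))) ∈ K0 := by
      fin_cases i
      · have heq : (![(1 : ↥(unitaryGroupOfForm (conjLocal L (IsCMField.complexConj L) v) (cmLocalForm L 3 v))), eA.symm (weylLongU (galAdicCompletionMap (L := L) (IsCMField.complexConj L) hw) (rfl : (StdForm.antidiagonal 3).over (w.1.adicCompletion L) = _))] (0 : Fin 2))⁻¹ * (h : ↥(unitaryGroupOfForm (conjLocal L (IsCMField.complexConj L) v) (cmLocalForm L 3 v))) * (![(1 : ↥(unitaryGroupOfForm (conjLocal L (IsCMField.complexConj L) v) (cmLocalForm L 3 v))), eA.symm (weylLongU (galAdicCompletionMap (L := L) (IsCMField.complexConj L) hw) (rfl : (StdForm.antidiagonal 3).over (w.1.adicCompletion L) = _))] (0 : Fin 2)) = h := by simp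
        have h' : (![(1 : ↥(unitaryGroupOfForm (conjLocal L (IsCMField.complexConj L) v) (cmLocalForm L 3 v))), eA.symm (weylLongU (galAdicCompletionMap (L := L) (IsCMField.complexConj L) hw) (rfl : (StdForm.antidiagonal 3).over (w.1.adicCompletion L) = _))] (0 : Fin 2))⁻¹ * (h : ↥(unitaryGroupOfForm (conjLocal L (IsCMField.complexConj L) v) (cmLocalForm L 3 v))) * (![(1 : ↥(unitaryGroupOfForm (conjLocal L (IsCMField.complexConj L) v) (cmLocalForm L 3 v))), eA.symm (weylLongU (galAdicCompletionMap (L := L) (IsCMField.complexConj L) hw) (rfl : (StdForm.antidiagonal 3).over (w.1.adicCompletion L) = _))] (0 : Fin 2)) ∈ I := hmem'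
        rw [heq] at h'
        exact hIK0 _ h'
      · have h' : (![(1 : ↥(unitaryGroupOfForm (conjLocal L (IsCMField.complexConj L) v) (cmLocalForm L 3 v))), eA.symm (weylLongU (galAdicCompletionMap (L := L) (IsCMField.complexConj L) hw) (rfl : (StdForm.antidiagonal 3).over (w.1.adicCompletion L) = _))] (1 : Fin 2))⁻¹ * (h : ↥(unitaryGroupOfForm (conjLocal L (IsCMField.complexConj L) v) (cmLocalForm L 3 v))) * (![(1 : ↥(unitaryGroupOfForm (conjLocal L (IsCMField.complexConj L) v) (cmLocalForm L 3 v))), eA.symm (weylLongU (galAdicCompletionMap (L := L) (IsCMField.complexConj L) hw) (rfl : (StdForm.antidiagonal 3).over (w.1.adicCompletion L) = _))] (1 : Fin 2)) ∈ I := hmem'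
        have hprod := mulK0 _ _ (mulK0 _ _ hw0 (hIK0 _ h')) (invK0 _ hw0)
        have heq : (![(1 : ↥(unitaryGroupOfForm (conjLocal L (IsCMField.complexConj L) v) (cmLocalForm L 3 v))), eA.symm (weylLongU (galAdicCompletionMap (L := L) (IsCMField.complexConj L) hw) (rfl : (StdForm.antidiagonal 3).over (w.1.adicCompletion L) = _))] (1 : Fin 2)) * ((![(1 : ↥(unitaryGroupOfForm (conjLocal L (IsCMField.complexConj L) v) (cmLocalForm L 3 v))), eA.symm (weylLongU (galAdicCompletionMap (L := L) (IsCMField.complexConj L) hw) (rfl : (StdForm.antidiagonal 3).over (w.1.adicCompletion L) = _))] (1 : Fin 2))⁻¹ * (h : ↥(unitaryGroupOfForm (conjLocal L (IsCMField.complexConj L) v) (cmLocalForm L 3 v))) * (![(1 : ↥(unitaryGroupOfForm (conjLocal L (IsCMField.complexConj L) v) (cmLocalForm L 3 v))), eA.symm (weylLongU (galAdicCompletionMap (L := L) (IsCMField.complexConj L) hw) (rfl : (StdForm.antidiagonal 3).over (w.1.adicCompletion L) = _))] (1 : Fin 2))) * (![(1 : ↥(unitaryGroupOfForm (conjLocal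 L (IsCMField.complexConj L) v) (cmLocalForm L 3 v))), eA.symm (weylLongU (galAdicCompletionMap (L := L) (IsCMField.complexConj L) hw) (rfl : (StdForm.antidiagonal 3).over (w.1.adicCompletion L) = _))] (1 : Fin 2))⁻¹ = h := by group
        rw [heq] at hprod
        exact hprod
    exact inducingLine_eq_one_of_mem_integralLevel L v h ((mem_K0_iff_mem_integralLevel L v w hw eA heA K0 hK0 _).1 hhK0)
  · rw [if_neg h1, Finset.card_eq_zero, Finset.filter_eq_empty_iff]
    obtain ⟨b, hb⟩ : ∃ b, ψ₀ b ≠ 1 := by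
      by_contra hall
      push Not at hall
      exact h1 (MonoidHom.ext fun b => by rw [hall b, MonoidHom.one_apply])
    obtain ⟨p, hpI, hval⟩ := exists_witness L v w hw eA heA hns hd g₁ hg₁ K0 K1 I hK0 hK1 hI ψ₀ b
    intro i _ hall
    have h1p := hall p (hpI i)
    rw [hval] at h1p
    have h11 := LinearMap.congr_fun h1p (1 : ℂ)
    rw [LinearMap.smul_apply, Module.End.one_apply, smul_eq_mul, mul_one] at h11
    exact hb (Units.val_eq_one.1 h11)

include heA in
open Classical in
set_option maxHeartbeats 1600000 in
set_option synthInstance.maxHeartbeats 400000 in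
-- instance-path unification between `Gqs L v` and the literal carrier of ★ `cmPrincipalSeries`
/-- **`dim i_G(χ_St(ψ₀))^{K₁} = 1` if `ψ₀ = 1`, `= 0` otherwise** (MACKEY over `G_v = B·K₁`, FILE C; `B ∩ K₁` has unit diagonal, §1; the witness of §2 lies in `I ≤ K₁`).
[cite: Borel1976, §3–§4] [cite: Casselman1995, Prop. 1.3.1, §3] [cite: Tits1979, §3.3.2] -/
theorem finrank_fixedPoints_cmPrincipalSeries_stChar_K1 (hns : ∀ w' : PlacesOver L v, IsCMField.complexConj L • w'.1 = w'.1) {ϖ : w.1.adicCompletion L} (hd : HermitianLattice.UnramifiedLocalConjDatum (galAdicCompletionMap (L := L) (IsCMField.complexConj L) hw) ϖ)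
    (g₁ : GL (Fin 3) (w.1.adicCompletion L)) (hg₁ : (g₁ : Matrix (Fin 3) (Fin 3) (w.1.adicCompletion L)) = Matrix.diagonal ![(1 : w.1.adicCompletion L), 1, ϖ])
    (K0 K1 I : Subgroup (Gqs L v))
    (hK0 : K0 = ((glInt 3 (w.1.adicCompletion L)).subgroupOf
      (unitaryGroupOfForm (galAdicCompletionMap (L := L) (IsCMField.complexConj L) hw) ((StdForm.antidiagonal 3).over (w.1.adicCompletion L)))).comap
        eA.toMulEquiv.toMonoidHom)
    (hK1 : K1 = (((glInt 3 (w.1.adicCompletion L)).map (MulAut.conj g₁).toMonoidHom).subgroupOf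
      (unitaryGroupOfForm (galAdicCompletionMap (L := L) (IsCMField.complexConj L) hw) ((StdForm.antidiagonal 3).over (w.1.adicCompletion L)))).comap
        eA.toMulEquiv.toMonoidHom)
    (hI : I = K0 ⊓ K1)
    (ψ₀ : ↥(normOneUnits (conjLocal L (IsCMField.complexConj L) v)) →* ℂˣ) :
    Module.finrank ℂ ((cmPrincipalSeries L 3 v (cmTorusCharPair L v (halfModulusChar (LocalRing L v) * halfModulusChar (LocalRing L v))⁻¹ ψ₀)).fixedPoints K1) = if ψ₀ = 1 then 1 else 0 := by
  haveI := locallyCompactSpace_cmBorelU L 3 v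
  have hK1o' := (isOpen_isCompact_levels L v w hw eA g₁ K0 K1 I hK0 hK1 hI).2.1.1
  have hK1o : @IsOpen ↥(unitaryGroupOfForm (conjLocal L (IsCMField.complexConj L) v) (cmLocalForm L 3 v)) inferInstance (K1 : Set (Gqs L v)) := hK1o'
  have hdisj : ∀ i j : Unit, (∃ h : ↥(cmBorelTriple L 3 v).P, ∃ κ : ↥(unitaryGroupOfForm (conjLocal L (IsCMField.complexConj L) v) (cmLocalForm L 3 v)), κ ∈ K1 ∧
      (fun _ : Unit => (1 : ↥(unitaryGroupOfForm (conjLocal L (IsCMField.complexConj L) v) (cmLocalForm L 3 v)))) j = (h : ↥(unitaryGroupOfForm (conjLocal L (IsCMField.complexConj L) v) (cmLocalForm L 3 v))) * (fun _ : Unit => (1 : ↥(unitaryGroupOfForm (conjLocal L (IsCMField.complexConj L) v) (cmLocalForm L 3 v)))) i * κ) → i = j := fun _ _ _ => Subsingleton.elim _ _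
  have hM := Representation.finrank_fixedPoints_smoothIndRep_eq_card_filter (Representation.twist
      (((Representation.trivial ℂ ↥(torusU (conjLocal L (IsCMField.complexConj L) v) (cmLocalForm L 3 v)) ℂ).twist
        (cmTorusCharPair L v (halfModulusChar (LocalRing L v) * halfModulusChar (LocalRing L v))⁻¹ ψ₀)).comp (cmBorelTriple L 3 v).proj)
      (rootDeltaChar (cmBorelTriple L 3 v).P)) hK1o
    (cover_borel_K1 L v w hw eA heA hd g₁ hg₁ K1 hK1) hdisj (Module.finrank_self ℂ)
  refine hM.trans ?_
  by_cases h1 : ψ₀ = 1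
  · subst h1
    rw [if_pos rfl, Finset.filter_true_of_mem, Finset.card_univ, Fintype.card_unit]
    intro i _ h hmem
    have hmem' : (1 : ↥(unitaryGroupOfForm (conjLocal L (IsCMField.complexConj L) v) (cmLocalForm L 3 v)))⁻¹ * (h : ↥(unitaryGroupOfForm (conjLocal L (IsCMField.complexConj L) v) (cmLocalForm L 3 v))) * 1 ∈ K1 := hmem
    rw [inv_one, one_mul, mul_one] at hmem'
    exact inducingLine_eq_one_of_mem_K1 L v w hw eA heA hd g₁ hg₁ K0 K1 I hK0 hK1 hI h hmem'
  · rw [if_neg h1, Finset.card_eq_zero, Finset.filter_eq_empty_iff]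
    obtain ⟨b, hb⟩ : ∃ b, ψ₀ b ≠ 1 := by
      by_contra hall
      push Not at hall
      exact h1 (MonoidHom.ext fun b => by rw [hall b, MonoidHom.one_apply])
    obtain ⟨p, hpI, hval⟩ := exists_witness L v w hw eA heA hns hd g₁ hg₁ K0 K1 I hK0 hK1 hI ψ₀ b
    intro i _ hall
    have hconj : (1 : ↥(unitaryGroupOfForm (conjLocal L (IsCMField.complexConj L) v) (cmLocalForm L 3 v)))⁻¹ * (p : ↥(unitaryGroupOfForm (conjLocal L (IsCMField.complexConj L) v) (cmLocalForm L 3 v))) * 1 ∈ K1 := by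
      rw [inv_one, one_mul, mul_one]
      have h0 := hpI 0
      have heq : (![(1 : ↥(unitaryGroupOfForm (conjLocal L (IsCMField.complexConj L) v) (cmLocalForm L 3 v))), eA.symm (weylLongU (galAdicCompletionMap (L := L) (IsCMField.complexConj L) hw) (rfl : (StdForm.antidiagonal 3).over (w.1.adicCompletion L) = _))] (0 : Fin 2))⁻¹ * (p : ↥(unitaryGroupOfForm (conjLocal L (IsCMField.complexConj L) v) (cmLocalForm L 3 v))) * (![(1 : ↥(unitaryGroupOfForm (conjLocal L (IsCMField.complexConj L) v) (cmLocalForm L 3 v))), eA.symm (weylLongU (galAdicCompletionMap (L := L) (IsCMField.complexConj L) hw) (rfl : (StdForm.antidiagonal 3).over (w.1.adicCompletion L) = _))] (0 : Fin 2)) = p := by simp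
      rw [heq] at h0
      exact I_le_K1 L v K0 K1 I hI h0
    have h1p := hall p hconj
    rw [hval] at h1p
    have h11 := LinearMap.congr_fun h1p (1 : ℂ)
    rw [LinearMap.smul_apply, Module.End.one_apply, smul_eq_mul, mul_one] at h11
    exact hb (Units.val_eq_one.1 h11)

end Summit.HodgeConjecture.HodgeConjecture.Cruxes.H413.F0P3cStCharTSStIwahoriFixed

end
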